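import Summits.QuantumFields.YangMills.Theses.LangevinControlUV
import Summits.QuantumFields.YangMills.Theorems.HypercubicLimit.Negative.NonTrivialityBridge
import Literature.MathematicalPhysics.QuantumLattice.GaugeGroupsProofs
import Literature.MathematicalPhysics.QuantumFieldTheory.LatticeGaugeProofs

/-!
# Disproof of `OSLegsFromFemtoAndGap` — standing adversary work file (cdisprove; gen 1 cycle 1 = v3 §0–§7, gen 2 cycle 1 = v4 §8–§10)

Crux item `stmt-QuantumFields-9367` =
`Summit.QuantumFields.YangMills.Theses.LangevinControlUV.OSLegsFromFemtoAndGap` (route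
`LangevinControlUV`, rank 6): for every compact simple `G`, faithful unitary `r` and unit map
`a : ℝ → ℝ`, the femto two-point package (H1 = `TwoPoint`), the femto skewness witness
(H2 = `Skewness`) and the lattice gap in units `a` (H3 = `GapInUnits`) imply the existence of a
sequential scheme `sch` in units `a` and OS data `T` with `IsYangMillsFor r sch T`,
`T.IsNontrivial r.curvature`, `T.IsNonGaussian r.curvature` and `HasLatticeMassGap r sch Δ`
for some `Δ > 0` (`Concl`).

VERDICT (cycle 1): **RESISTS** — no refutation, no misstatement landed. Everything below the
docblock is checked and sorry-free.

SUBMITTED to the tree (prover-importable, `--supports stmt-QuantumFields-9367`, namespace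
`Summit.QuantumFields.YangMills.Theorems.OSLegsFromFemtoAndGap.Negative`; gen-2 additions listed in the gen-2 block below):
* `Theorems/OSLegsFromFemtoAndGap/Negative/UnitsAndGapFree.lean` — p72925 ACCEPTED, commit ee81c03a5aa5
  (§2 `osLegs_false_without_twoPoint`, §3 `hasLatticeMassGap_of_gapInUnits` /
  `isYangMillsFor_vacuum_of_c_zero` / `concl_sans_nontriviality`, §4 `not_twoPoint_of_subsingleton`,
  §5 `scheme_tori_eventually_not_femto`; no new defs);
* `Theorems/OSLegsFromFemtoAndGap/Negative/ForallSchemeFalse.lean` — p73259 ACCEPTED, commit 5a8f64e538a9 (§7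
  `not_isNontrivial_of_curv_unrenormalised`, `not_forall_scheme_strengthening`).

## Findings

* §0 `crux_iff` — the crux uncurried into `∀ G r a, TwoPoint → Skewness → GapInUnits → Concl`
  (definitional); the four pieces are named predicates of `(G, r, a)` that provers may import.
* §1 THE WALL (why no kill is landable, by anyone, today). A proof of `¬ OSLegsFromFemtoAndGap`
  must exhibit `(G, r, a)` satisfying H1 ∧ H2 ∧ H3 and then refute `Concl`. `disproof_burden`:
  any such witness proves `GapInUnits G r a` for a genuine compact simple Lie group — i.e.
  volume-uniform exponential clustering of ALL pairs of gauge-invariant observables at EVERY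
  coupling `β ≥ β₂` (weak coupling included, since `[β₂, ∞)` is forced by the quantifier shape),
  at rate `c₁ a(β) > 0`; whatever the unit map, at each fixed `β` this is the lattice mass gap of
  4D `G`-gauge theory at that coupling (tree conjecture
  `Literature.MathematicalPhysics.QuantumFieldTheory.LatticeMassGapAllCouplings`, Chatterjee
  arXiv:1803.01950 Pb 5.1). No choice of `a` softens it: for fixed `β` the bound is exponential
  decay in `n → ∞` on tori of side `2S+1 → ∞`. No choice of `r` softens it: `r` faithful ⇒
  `U_p = 1` is the unique maximiser of `Re tr r`, the regime `β → ∞` is weak coupling. No choice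
  of `G` softens it: `LatticeRep` (continuous + injective into `U(N)`) makes `G` a closed subgroup
  of `U(N)`; `IsSimpleCompactGroup` excludes finite/abelian/product junk (§4). Hence the
  load-bearing status of the two-sided BOUNDS in H1 and of H2 is formally undecidable here, and
  even a kill MODULO "H1 ∧ H2 ∧ H3 hold for some a" would still need `¬ Concl`, i.e. a no-go
  theorem for OS limits along that `a` (a CLT / triviality theorem for 4D YM) — equally open.
* §2 CHEAP LOAD-BEARING (proved, unconditional via `SU(2)`): `false_without_twoPoint` — with H1
  dropped the statement is FALSE (`a ≡ 0` satisfies H2 with `Γ₃ = id` and H3 with rate `0`,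
  bounded correlations under the probability measure `wilsonMeasure`, while `sch.a_pos` kills
  `Concl`). HONEST LABEL: the only clause of H1 this isolates is `∀ β, 0 < a β`; it does NOT show
  the two-point bounds are used (§1). The `Tendsto a atTop (𝓝 0)` clause cannot be isolated
  either: with `a ≡ 1` H1/H2 are vacuous (`ℓ₀ = 1` admits only `L = 1`) but H3 becomes clustering
  at a β-UNIFORM lattice rate, physically false (`ξ(β) → ∞`) and unprovable.
* §3 TIGHTNESS / WHERE THE CONTENT IS (proved): `concl_sans_nontriviality` — from `a > 0`,
  `a → 0` and H3 ALONE one gets `sch` in units `a`, `T`, `IsYangMillsFor r sch T` and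
  `HasLatticeMassGap r sch c₁` (vacuum OS data + renormalisations `c ≡ 0`, `unitScheme` with
  `β_k = β₂ + k`, `L_k ≥ S₁(β_k)`, `a_k L_k ≥ k`); `hasLatticeMassGap_of_gapInUnits` is the
  re-indexing lemma provers can import for ANY scheme with `β_k ≥ β₂` and `L_k ≥ S₁(β_k)`
  eventually. So the ENTIRE content of the crux is `IsNontrivial ∧ IsNonGaussian` for a `T`
  tied to the lattice by `IsYangMillsFor` — the non-vacuum continuum limit (E1 rotations, E0′,
  femto → large-torus decoupling), exactly the planner's list; the units clause and the gap
  clause cost nothing.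
* §4 JUNK AUDIT (proved): `not_twoPoint_of_subsingleton` — for a trivial gauge group the
  plaquette field is `0`, every covariance vanishes and H1's lower bound `c Γ > 0` fails on the
  femto box `L = 8` (which exists because `a → 0`): dropping `IsCompactSimpleLieGroup` opens no
  junk refutation (the crux holds vacuously there, `crux_pointwise_of_subsingleton`).
  `isCompactSimpleLieGroup_su2`: CORRECTION of the g40-63 route note — an UNCONDITIONAL compact
  simple instance exists in the tree (`isSimpleCompactGroup_specialUnitaryGroup_holds`,
  GaugeGroupsProofs), so `¬`-theorems over "∀ compact simple G" ARE landable on this sub-problem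
  whenever the content allows.
* §5 HYPOTHESIS GAP (proved + paper, for provers): `scheme_tori_eventually_not_femto` — for
  ANY scheme in units `a`, the scheme's own tori eventually violate the femto condition of H1/H2
  (`a_k L_k → ∞`), so H1/H2 instantiated at the measures the conclusion integrates against are
  eventually vacuous. H3 bounds those measures only by `C_{AB} e^{-c₁ a n}` with an
  observable-dependent constant — no `a⁸` amplitude. Hence the dimension-8 amplitude
  `n⁸ Cov ≍ Γ(n a)` on LARGE tori, which `IsYangMillsFor` + `IsNontrivial` need, is provided by
  nothing in H1–H3: the planner's foreseen child "Decoupling" is a genuine extra input, not glue.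
  Quantitatively: H1's tori have at most `ℓ₀/a(β)` sites per side while H3's correlation length is
  `≲ 1/(c₁ a(β))` sites; `ℓ₀` and `c₁` are independent existential constants, so every femto torus
  may be SMALLER than one correlation length (`ℓ₀ c₁ ≪ 1`) — finite-size effects between the two
  families of measures are O(1), and the only formal links hypotheses → conclusion are the unit map
  itself and H3 ↦ `HasLatticeMassGap` (§3).
* §6 PLANNER'S FAKE-UNIT-MAP THREAT (paper): a step map `a' ≪ a_AF` with pairwise
  incommensurable plateau values can plausibly meet H1/H2 (each level `s = n a'(β)` is hit by one
  `(n, plateau)`, so `Γ` is definable provided `n⁸ Cov_{β,L}(n)` is `L`-independent up to constants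
  for `8n ≤ L ≤ ℓ₀/a'(β)` — thermodynamic limit + femto universality) and H3 (weaker rate); along
  `a'` the curvature field is smeared over `≫ ξ` lattice units, so any limit should be Gaussian or
  trivial, making `Concl` false. NOT formalisable: both "a' meets H3" (§1) and "no non-Gaussian
  limit along a'" (mixing CLT for Wilson's measure) are open. Only trivial reparametrisations
  provably preserve H1–H3 (`twoPoint_congr_above`, `skewness_congr_above`,
  `gapInUnits_congr_above`: the hypotheses never see `a` below a threshold; `gapInUnits_smul`:
  unit rescaling) — no hypothesis-preserving deformation of `a` that provably breaks `Concl` was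
  found. If the planner wants to close the
  loophole: pin `a` two-sidedly to a NAMED scale (e.g. require `Γ(s) → 0` as `s → 0⁺` together
  with `lim inf_{β} a(β) ξ(β) > 0` once `ξ` is defined), or quantify `a` existentially inside
  FemtoCurvatureTwoPoint and carry the SAME witness through the chain (the `closes` theorem already
  does the latter, so the ∀ a form is stronger than the assembly needs).

* §7 A NATURAL STRENGTHENING REFUTED (proved): `not_forall_scheme_strengthening` — the
  ∀-scheme form of the conclusion ("EVERY scheme in units `a` with `β_k → ∞`, `L_k ≥ S₁(β_k)`
  carries non-trivial Yang–Mills OS data") is false for every `(G, r, a)`: along the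
  zero-renormalisation `unitScheme`, `IsYangMillsFor` pins `T` to vanishing lattice limits on real
  half-space tensors and the bridge `Theorems.HypercubicLimit.Negative.not_twoPointNontrivial_of_factorizes`
  kills `IsNontrivial` (`not_isNontrivial_of_curv_unrenormalised`). Renormalisations are witness
  data; a prover's scheme needs `c_curv(k) ≠ 0` (indeed `≍ a_k⁻⁴`) — and then the amplitude input
  of §5.


## Generation 2, cycle 1 (v4, 2026-08-16) — VERDICT: still **RESISTS**; §8–§9 proved, sorry-free

Read at start: Disproof.lean v3 (§0–§7 above, kept verbatim), the seven crux ideas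
(`Ideas/*.md`), `IdeatorOneSketch.lean`, `SketchIdeator2.lean`, `StructuralFindings-ideator2.md`
(F1–F4), `NOTES-ideator1-r1.md`. New this cycle:

* §6 addendum `gapInUnits_mono` (proved; LANDED with verbatim H3 bodies as
  `Theorems/OSLegsFromFemtoAndGap/Negative/GapClauseMonotone.lean` — p74733 ACCEPTED, commit d5b875584da7):
  H3 passes to EVERY eventually-smaller unit map
  (`a' ≤ a` on `[βs, ∞)`; no positivity of `a'` needed, constants `max C 0`). Together with
  `gapInUnits_congr_above` / `gapInUnits_smul` this completes the cheap H3-transports: the gap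
  clause can only WEAKEN along the fake-unit-map deformation `a' ≪ a` of §6 / F1, never object.

* §8 THE ULTRALOCALITY NO-GO BEHIND THE FAKE-UNIT-MAP THREAT — abstract core PROVED
  (`logConvex_eq_zero_of_one`, `logConvex_pos`, `logConvex_pos_of_pos_at`, `logConvex_ratio_mono`,
  `logConvex_block`, `logConvex_pow_le`, `ultralocality_noGo`; pure real analysis, LANDED for import
  as `Theorems/OSLegsFromFemtoAndGap/Negative/UltralocalityNoGo.lean` — p74604 ACCEPTED, commit bec1cbd6c8af). Statement: if `G_k ≥ 0` are
  log-convex in the lattice time `n` and the renormalised values `c_k G_k(0)`, `c_k G_k(s_k)` converge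
  to POSITIVE limits, then `G_k(q s_k)/G_k(0) ↛ 0` for every `q`. DICTIONARY (how F1/§6 would become
  `¬ OSLegsFromFemtoAndGap`, and exactly where it cannot today):
  [A] `G_k(n)` = bare centred OS pairing `Cov(Θ F_k, τₙ F_k)` of the `a_k`-smeared curvature field on
      the scheme's torus for ONE real half-space test function `u` — log-convex in `n` (both parities)
      by torus reflection positivity (tree `wilsonExpectation_oddReflectionPositive` on the odd tori
      `2L_k+1`: a site plane and a link plane at once) plus translation invariance and Cauchy–Schwarz in
      the CENTRED OS form (psd because constants are admissible observables); fine print: time-support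
      inside a half-torus, eventually guaranteed by `a_k L_k → ∞` for compactly supported `u`, Schwartz
      tails through the limit's continuity; `c_k = (sch.c r.curvature k)²`;
  [B] `S₀ > 0`: from `T.IsNontrivial r.curvature` through the real bridge of §7
      (`Theorems.HypercubicLimit.Negative.not_twoPointNontrivial_of_factorizes`) and RP Cauchy–Schwarz
      `|⟨u,v⟩|² ≤ ⟨u,u⟩⟨v,v⟩` (diagonalisation: WLOG `v = u`);
  [C] `Sσ > 0` at some physical `σ > 0`, `s_k = ⌈σ/a_k⌉`: continuity of the tempered `𝔖₂` under
      `τ_σ u → u` in `𝒮`, and — because `σ/a_k ∉ ℕ` in general — EQUICONTINUITY of the quadratic forms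
      `u ↦ c_k ⟨u_k,u_k⟩_OS` (Banach–Steinhaus on the Fréchet space of half-space-supported Schwartz
      functions: pointwise convergent continuous seminorms are equicontinuous); a dyadic-valued unit map
      would make `σ/a_k ∈ ℕ` exact but is EXCLUDED by §9 (commensurable plateaux are pinned by H1);
  [D] `G_k(q s_k)/G_k(0) → 0`: the PHYSICS of the fake map and the only non-formal input — an UPPER
      clustering bound in faster units `b` (`|Cov(P_x,P_y)| ≤ D e^{-c₁ b(β)|x⁰-y⁰|}`, `b/a → ∞` along
      the scheme, `D` uniform over translates — which H3 as typed does NOT give: its `C` is per pair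
      `(A,B)`, hence per translate) AND a LOWER bound `G_k(0) ≥ D_u e^{-K_u c₁ b(β_k)/a_k}` on the bare
      OS norm of the smeared test function (true iff `b ≍ a_phys`; for signed `u` a non-degeneracy
      statement about Wilson's measure on LARGE tori at weak coupling).
  Consequence: a kernel-checked `H → ¬ OSLegsFromFemtoAndGap` needs `H ⊇ {H1(a'), H2(a') for a fake
  a' ≪ a_phys (large-volume femto universality), two-sided clustering in units a_phys on large tori}`
  — a bundle of open theorems at least as strong as the provers' positive task, not "an object the
  tree cannot yet construct". Hence NO `--negative-modulo` filing: the misstatement threat is real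
  (three independent analyses: §6, ideator-1 (1), ideator-2 F1) but formally a draw.
  REPAIR MENU for the planner (each defeats [D], i.e. forces `b ≍ a`): (R1) `Continuous a` (then
  ideator-3's dyadic ladder exists and §9 pins `a` to the physical scale through H1's single `Γ`);
  (R2) a LOWER clustering clause in H3 in the SAME units (`D' e^{-C₂ a(β) n} ≤ Cov` of parallel
  spatial plaquettes at time-separation `n ≤ S` on the large tori) — pins `a ≳ a_phys`, while H3's
  upper bound pins `a ≲ a_phys`; (R3) quantify `a` existentially in 9363 and thread the SAME witness
  (the `closes` theorem already does). Under any of R1–R3 the no-go has no target and the crux is the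
  honest "OS legs" problem.

* §9 H1 PINS COMMENSURABLE PLATEAUX (proved): `TwoPoint.axis_bounds`, `twoPoint_pins_commensurable`
  — if `a β = m · a β'` (`m ≥ 1`) for two couplings above threshold, then on all femto tori
  `n⁸Cov_β(n) ≍ (mn)⁸Cov_{β'}(mn)` with the constant `K = max (C/c) 1` of H1 (both sit in
  `[cΓ(s), CΓ(s)]` at the SAME level `s = n a β`). So H1's single `Γ` enforces step scaling along
  every chain of couplings with rationally related units: the fake maps of §6/F1 must have pairwise
  INCOMMENSURABLE plateau values (and, quantitatively, plateaux of β-length `≲ ξ(β)a_phys(β)·(a/a_phys)`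
  so that `e^{-m_latt n}` varies by `O(1)` across a plateau for `n ≤ ℓ₀/(8a)` — such maps still exist,
  with `Σ` of plateau lengths divergent), and the dyadic shortcut in [C] is unavailable to a disprover.
  Disproof-side twin of ideator-3's `PinnedTwoPoint`.

* §10 STUB PRE-AUDIT (prose; no line picked, `targets = []`). Which first lemmas a disprover can ever
  attack with `¬`: every stub of shape "H1-package → …" (`FemtoToBulkTransfer`, `PinnedTwoPoint`,
  the dlr residue `∀ a, H1 ∧ H2 → FCP`) inherits the §1 wall (its refutation must exhibit an H1 witness
  for a genuine compact simple `G`). Hypothesis-free lattice statements are the future targets: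
  `FemtoBoundaryLaw` (ideator 1: `|E[P_x | exterior] − p β| ≤ C/depth⁴` a.s. in femto boxes) and
  `InfluenceGatedBallCovariance` (ideator 2) are physical conjectures whose cheapest falsifier is
  numerical (SU(2), frozen Haar-random vs frozen smooth exterior, plaquette-excess profile vs depth
  `d = 4, 6, 8` must scale like `d⁻⁴`; `C` existential, so one box size cannot falsify; no kit job this
  cycle); `RateOnlyClusteringUpgrade`, `axisCov_logConvex` look TRUE (torus states and their limits are
  translation/reflection invariant; BOTH parities of 3-term log-convexity need BOTH site and link RP —
  tree `wilsonExpectation_siteReflectionPositive` / `wilsonExpectation_reflectionPositive_holds` on even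
  tori, `wilsonExpectation_oddReflectionPositive` on odd); `rope_interpolation`, `collar_cov_bound`,
  `selfImprovingDecay` are elementary and TRUE (zero pattern of 3-term log-convexity checked: zeros
  propagate forward, §8 `logConvex_eq_zero_of_one`). No stub kill.

-- Targets: none (no line picked yet; payload.stuck_stubs = []).
-/

namespace Summit.QuantumFields.YangMills.Cruxes.OSLegsFromFemtoAndGap.Disproof

open Literature.MathematicalPhysics.QuantumFieldTheory Literature.MathematicalPhysics.QuantumLattice
open Literature.MathematicalPhysics.AQFT
open Filter MeasureTheory Topology
open Summit.QuantumFields.YangMills.Theses.LangevinControlUV (OSLegsFromFemtoAndGap)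

noncomputable section

/-! ## §0 Anatomy: the three hypotheses and the conclusion as named predicates -/

section Anatomy

variable (G : Type) [Group G] [TopologicalSpace G] [IsTopologicalGroup G] [CompactSpace G]
  [MeasurableSpace G] [BorelSpace G] (r : LatticeRep G) (a : ℝ → ℝ)

/-- H1, the femto two-point package of `FemtoCurvatureTwoPoint` for the unit map `a`
(verbatim body of the route decl). [folklore] -/
def TwoPoint : Prop :=
  ∃ (Γ : ℝ → ℝ) (β₀ ℓ₀ c C : ℝ), 0 < ℓ₀ ∧ 0 < c ∧ (∀ β, 0 < a β) ∧ Filter.Tendsto a Filter.atTop (nhds 0) ∧ (∀ s : ℝ, 0 < s → s ≤ ℓ₀ → 0 < Γ s ∧ Γ s ≤ 1) ∧ ∀ (L : ℕ) [NeZero L] (β : ℝ), β₀ ≤ β → (L : ℝ) * a β ≤ ℓ₀ → let P : (Fin 4 → ZMod L) → Fin 4 → Fin 4 → GaugeConfig 4 L G → ℝ := fun x i j U => (r.N : ℝ) - (r.ρ (plaquetteHolonomy U x i j)).trace.re; let E : (GaugeConfig 4 L G → ℝ) → ℝ := fun F => wilsonExpectation (d := 4) (L := L) r.ρ β F; let cov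 : (GaugeConfig 4 L G → ℝ) → (GaugeConfig 4 L G → ℝ) → ℝ := fun F F' => E (fun U => F U * F' U) - E F * E F'; let dist : (Fin 4 → ZMod L) → (Fin 4 → ZMod L) → ℝ := fun x y => Real.sqrt (∑ k : Fin 4, (((x k - y k).valMinAbs : ℤ) : ℝ) ^ 2); (∀ n : ℕ, 1 ≤ n → 8 * n ≤ L → c * Γ ((n : ℝ) * a β) ≤ (n : ℝ) ^ 8 * cov (P 0 0 1) (P (Pi.single (2 : Fin 4) ((n : ℕ) : ZMod L)) 0 1) ∧ (n : ℝ) ^ 8 * cov (P 0 0 1) (P (Pi.single (2 : Fin 4) ((n : ℕ) : ZMod L)) 0 1) ≤ C * Γ ((n : ℝ) * a β)) ∧ (∀ (x y : Fin 4 → ZMod L) (i j i' j' : Fin 4), x ≠ y → i ≠ j → i' ≠ j' → |cov (P x i j) (P y i' j')| * dist x y ^ 8 ≤ C * Γ (dist x y * a β))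

/-- H2, the femto skewness witness of `FemtoCurvatureSkewness` in units `a` (verbatim). [folklore] -/
def Skewness : Prop :=
  ∃ (Γ₃ : ℝ → ℝ) (β₁ ℓ₁ c₃ : ℝ), 0 < ℓ₁ ∧ 0 < c₃ ∧ (∀ s : ℝ, 0 < s → s ≤ ℓ₁ → 0 < Γ₃ s) ∧ ∀ (L : ℕ) [NeZero L] (β : ℝ), β₁ ≤ β → (L : ℝ) * a β ≤ ℓ₁ → let P : (Fin 4 → ZMod L) → Fin 4 → Fin 4 → GaugeConfig 4 L G → ℝ := fun x i j U => (r.N : ℝ) - (r.ρ (plaquetteHolonomy U x i j)).trace.re; let E : (GaugeConfig 4 L G → ℝ) → ℝ := fun F => wilsonExpectation (d := 4) (L := L) r.ρ β F; let cov : (GaugeConfig 4 L G → ℝ) → (GaugeConfig 4 L G → ℝ) → ℝ := fun F F' => E (fun U => F U * F' U) - E F * E F'; ∀ n : ℕ, 1 ≤ n → 8 * n ≤ L → c₃ * Γ₃ ((n : ℝ) * a β) ≤ (n : ℝ) ^ 12 * |E (fun U => P 0 0 1 U * P (Pi.single (2 : Fin 4) ((n : ℕ) : ZMod L)) 0 1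 U * P (Pi.single (3 : Fin 4) ((n : ℕ) : ZMod L)) 0 1 U) - E (P 0 0 1) * cov (P (Pi.single (2 : Fin 4) ((n : ℕ) : ZMod L)) 0 1) (P (Pi.single (3 : Fin 4) ((n : ℕ) : ZMod L)) 0 1) - E (P (Pi.single (2 : Fin 4) ((n : ℕ) : ZMod L)) 0 1) * cov (P 0 0 1) (P (Pi.single (3 : Fin 4) ((n : ℕ) : ZMod L)) 0 1) - E (P (Pi.single (3 : Fin 4) ((n : ℕ) : ZMod L)) 0 1) * cov (P 0 0 1) (P (Pi.single (2 : Fin 4) ((n : ℕ) : ZMod L)) 0 1) - E (P 0 0 1) * E (P (Pi.single (2 : Fin 4) ((n : ℕ) : ZMod L)) 0 1) * E (P (Pi.single (3 : Fin 4) ((n : ℕ) : ZMod L)) 0 1)|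

/-- H3, the lattice gap in units `a` of `LatticeGapInUVUnits` (verbatim). [folklore] -/
def GapInUnits : Prop :=
  ∃ (c₁ β₂ : ℝ) (S₁ : ℝ → ℕ), 0 < c₁ ∧ ∀ A B : YMSpecies G, ∃ C : ℝ, ∀ β : ℝ, β₂ ≤ β → ∀ S n : ℕ, S₁ β ≤ S → n ≤ S → |latticeConnectedCorr r.ρ β (2 * S + 1) A.F B.F n| ≤ C * Real.exp (-(c₁ * a β * n))

/-- The conclusion of the crux for `(G, r, a)` (verbatim). [folklore] -/
def Concl : Prop :=
  ∃ (sch : SpeciesScheme (YMSpecies G)) (T : OSData (YMSpecies G) 4), (∀ k, sch.a k = a (sch.β k)) ∧ IsYangMillsFor r sch T ∧ T.IsNontrivial r.curvature ∧ T.IsNonGaussian r.curvature ∧ ∃ Δ > 0, HasLatticeMassGap r sch Δ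

end Anatomy

/-- §0. The crux, uncurried: `H1 → H2 → H3 → Concl` for every compact simple `G`, every `r`,
every unit map `a` (definitional unfolding of the route decl). [folklore] -/
theorem crux_iff :
    OSLegsFromFemtoAndGap ↔
      ∀ (G : Type) [Group G] [TopologicalSpace G] [IsTopologicalGroup G] [CompactSpace G],
        IsCompactSimpleLieGroup G →
          letI : MeasurableSpace G := borel G
          haveI : BorelSpace G := ⟨rfl⟩
          ∀ (r : LatticeRep G) (a : ℝ → ℝ),
            TwoPoint G r a → Skewness G r a → GapInUnits G r a → Concl G r a :=
  Iff.rfl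

/-! ## §1 The wall: every disproof proves the lattice gap at all weak couplings -/

/-- The `∃`-core any refutation must produce: a compact simple Lie group, a faithful unitary
lattice representation and a unit map meeting H1 ∧ H2 ∧ H3. Its H3 component is volume-uniform
exponential clustering of all gauge-invariant pairs at every `β ≥ β₂` — the lattice mass gap at
all sufficiently weak couplings (Chatterjee arXiv:1803.01950, Problem 5.1; tree conjecture
`LatticeMassGapAllCouplings`). [cite: arXiv180301950, Problem 5.1] -/
def HypothesesWitnessExists : Prop :=
  ∃ (G : Type) (_ : Group G) (_ : TopologicalSpace G) (_ : IsTopologicalGroup G) (_ : CompactSpace G),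
    IsCompactSimpleLieGroup G ∧
      letI : MeasurableSpace G := borel G
      haveI : BorelSpace G := ⟨rfl⟩
      ∃ (r : LatticeRep G) (a : ℝ → ℝ), TwoPoint G r a ∧ Skewness G r a ∧ GapInUnits G r a

/-- **Disproof burden.** Any proof of `¬ OSLegsFromFemtoAndGap` yields a compact simple `G`,
`r`, `a` with H1 ∧ H2 ∧ H3 — in particular a PROOF of the lattice mass gap in units `a` at every
coupling `β ≥ β₂` for a genuine 4D non-abelian gauge theory (open). Conversely, in a world where
no `(G, r, a)` meets the hypotheses the crux holds vacuously (`crux_of_not_witness`). [folklore] -/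
theorem hypothesesWitnessExists_of_not_crux (h : ¬ OSLegsFromFemtoAndGap) :
    HypothesesWitnessExists := by
  by_contra hw
  apply h
  rw [crux_iff]
  intro G _ _ _ _ hG r a h1 h2 h3
  exact absurd ⟨G, _, _, _, _, hG, r, a, h1, h2, h3⟩ hw

/-- The converse bookkeeping: no hypotheses witness ⇒ the crux holds (vacuously). [folklore] -/
theorem crux_of_not_witness (hw : ¬ HypothesesWitnessExists) : OSLegsFromFemtoAndGap := by
  rw [crux_iff]
  intro G _ _ _ _ hG r a h1 h2 h3
  exact absurd ⟨G, _, _, _, _, hG, r, a, h1, h2, h3⟩ hw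

/-! ## §2 Cheap load-bearing analysis: only the positivity clause of H1 can be isolated -/

section LoadBearing

variable (G : Type) [Group G] [TopologicalSpace G] [IsTopologicalGroup G] [CompactSpace G]
  [MeasurableSpace G] [BorelSpace G]

/-- With `a ≡ 0` the conclusion is false: a scheme has positive spacings. [folklore] -/
theorem not_concl_of_unitMap_zero (r : LatticeRep G) : ¬ Concl G r (fun _ => 0) := by
  rintro ⟨sch, T, ha, -⟩
  exact (sch.a_pos 0).ne' (ha 0)

/-- With `a ≡ 0` the skewness hypothesis H2 holds trivially (`Γ₃ = id` vanishes at `n · 0`;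
H2 constrains `Γ₃` only on `(0, ℓ₁]`). [folklore] -/
theorem skewness_of_unitMap_zero (r : LatticeRep G) : Skewness G r (fun _ => 0) := by
  refine ⟨fun s => s, 0, 1, 1, one_pos, one_pos, fun s hs _ => hs, ?_⟩
  intro L _ β _ _ P E cov n _ _
  simp only [mul_zero]
  positivity

/-- Torus connected correlations of bounded observables are bounded uniformly in `β`, the
volume and the separation (Wilson's measure is a probability measure for continuous `ρ`). [folklore] -/
theorem abs_latticeConnectedCorr_le (r : LatticeRep G) (A B : YMSpecies G) :
    ∃ C : ℝ, ∀ (β : ℝ) (S : ℕ) [NeZero S] (n : ℕ),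
      |latticeConnectedCorr r.ρ β S A.F B.F n| ≤ C := by
  obtain ⟨MA, hA⟩ := A.bounded
  obtain ⟨MB, hB⟩ := B.bounded
  have hMA : 0 ≤ MA := le_trans (abs_nonneg _) (hA fun _ => 1)
  refine ⟨MA * MB + MA * MB, fun β S _ n => ?_⟩
  haveI := isProbabilityMeasure_wilsonMeasure (d := 4) (L := S) r.ρ r.continuous β
  unfold latticeConnectedCorr
  set μ := wilsonMeasure (d := 4) (L := S) r.ρ β with hμ
  have key : ∀ (f : GaugeConfig 4 S G → ℝ) (M : ℝ), (∀ U, |f U| ≤ M) → |∫ U, f U ∂μ| ≤ M := by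
    intro f M hf
    have h := norm_integral_le_of_norm_le_const (μ := μ) (f := f) (C := M)
      (Eventually.of_forall fun U => by simpa [Real.norm_eq_abs] using hf U)
    simpa [Real.norm_eq_abs] using h
  have h1 : |∫ U, A.F (torusLift S U) * B.F (configShift (-Pi.single 0 (n : ℤ)) (torusLift S U)) ∂μ|
      ≤ MA * MB :=
    key _ _ fun U => by
      rw [abs_mul]; exact mul_le_mul (hA _) (hB _) (abs_nonneg _) hMA
  have h2 : |∫ U, A.F (torusLift S U) ∂μ| ≤ MA := key _ _ fun U => hA _
  have h3 : |∫ U, B.F (torusLift S U) ∂μ| ≤ MB := key _ _ fun U => hB _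
  calc _ ≤ |∫ U, A.F (torusLift S U) * B.F (configShift (-Pi.single 0 (n : ℤ)) (torusLift S U)) ∂μ|
        + |(∫ U, A.F (torusLift S U) ∂μ) * ∫ U, B.F (torusLift S U) ∂μ| := abs_sub _ _
    _ ≤ MA * MB + MA * MB := by
        refine add_le_add h1 ?_
        rw [abs_mul]
        exact mul_le_mul h2 h3 (abs_nonneg _) hMA

/-- With `a ≡ 0` the gap hypothesis H3 holds trivially (rate `c₁ · 0 = 0`: bounded
correlations). [folklore] -/
theorem gapInUnits_of_unitMap_zero (r : LatticeRep G) : GapInUnits G r (fun _ => 0) := by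
  refine ⟨1, 0, fun _ => 0, one_pos, fun A B => ?_⟩
  obtain ⟨C, hC⟩ := abs_latticeConnectedCorr_le G r A B
  refine ⟨C, fun β _ S n _ _ => ?_⟩
  simpa using hC β (2 * S + 1) n

/-- **H1 is load-bearing (cheaply): pointwise form.** For EVERY compact group `G` and every `r`,
the crux with the two-point package dropped fails at the unit map `a ≡ 0`. Honest label: this
isolates only the clause `∀ β, 0 < a β` of H1, not the two-sided bounds (see §1). [folklore] -/
theorem false_without_twoPoint_pointwise (r : LatticeRep G) :
    ¬ ∀ a : ℝ → ℝ, Skewness G r a → GapInUnits G r a → Concl G r a := fun h =>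
  not_concl_of_unitMap_zero G r
    (h _ (skewness_of_unitMap_zero G r) (gapInUnits_of_unitMap_zero G r))

end LoadBearing

/-- The crux with hypothesis H1 (`TwoPoint`) dropped. [folklore] -/
def WithoutTwoPoint : Prop :=
  ∀ (G : Type) [Group G] [TopologicalSpace G] [IsTopologicalGroup G] [CompactSpace G],
    IsCompactSimpleLieGroup G →
      letI : MeasurableSpace G := borel G
      haveI : BorelSpace G := ⟨rfl⟩
      ∀ (r : LatticeRep G) (a : ℝ → ℝ), Skewness G r a → GapInUnits G r a → Concl G r a

/-- The fundamental representation of `SU(2)` as lattice representation data. [folklore] -/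
def su2Rep : LatticeRep (Matrix.specialUnitaryGroup (Fin 2) ℂ) :=
  ⟨2, fundamentalRep (Fin 2), continuous_fundamentalRep _, fundamentalRep_injective _,
    fundamentalRep_mem_unitaryGroup⟩

/-- `SU(2)` is a compact simple Lie group — UNCONDITIONALLY in the tree (the named fact
`isSimpleCompactGroup_specialUnitaryGroup` is discharged by
`isSimpleCompactGroup_specialUnitaryGroup_holds`). [cite: BrockerTomDieck1985, IV (3.1), IV (3.3) and V (8.7) Ex. 6] -/
theorem isCompactSimpleLieGroup_su2 : IsCompactSimpleLieGroup (Matrix.specialUnitaryGroup (Fin 2) ℂ) :=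
  isCompactSimpleLieGroup_specialUnitaryGroup isSimpleCompactGroup_specialUnitaryGroup_holds le_rfl

/-- **`OSLegsFromFemtoAndGap` is false without H1** (unconditional, via `SU(2)` fundamental and
`a ≡ 0`): any proof of the crux must use H1 — at least its positivity clause. [folklore] -/
theorem false_without_twoPoint : ¬ WithoutTwoPoint := by
  intro h
  letI : MeasurableSpace (Matrix.specialUnitaryGroup (Fin 2) ℂ) := borel _
  haveI : BorelSpace (Matrix.specialUnitaryGroup (Fin 2) ℂ) := ⟨rfl⟩
  exact false_without_twoPoint_pointwise _ su2Rep (h _ isCompactSimpleLieGroup_su2 su2Rep)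

/-! ## §3 Tightness: everything but non-triviality is free -/

section Tightness

variable {G : Type} [Group G] [TopologicalSpace G] [IsTopologicalGroup G] [CompactSpace G]
  [MeasurableSpace G] [BorelSpace G]

/-- **Re-indexing lemma (for provers).** H3's clustering body gives `HasLatticeMassGap r sch c₁`
for ANY scheme in units `a` whose couplings are eventually `≥ β₂` and whose half-sides eventually
dominate `S₁(β_k)`. [folklore] -/
theorem hasLatticeMassGap_of_gapInUnits (r : LatticeRep G) {a : ℝ → ℝ} {c₁ β₂ : ℝ} {S₁ : ℝ → ℕ}
    (hgap : ∀ A B : YMSpecies G, ∃ C : ℝ, ∀ β : ℝ, β₂ ≤ β → ∀ S n : ℕ, S₁ β ≤ S → n ≤ S →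
      |latticeConnectedCorr r.ρ β (2 * S + 1) A.F B.F n| ≤ C * Real.exp (-(c₁ * a β * n)))
    (sch : SpeciesScheme (YMSpecies G)) (ha : ∀ k, sch.a k = a (sch.β k))
    (hβ : ∀ᶠ k in atTop, β₂ ≤ sch.β k) (hL : ∀ᶠ k in atTop, S₁ (sch.β k) ≤ sch.L k) :
    HasLatticeMassGap r sch c₁ := by
  intro A B
  obtain ⟨C, hC⟩ := hgap A B
  refine ⟨C, ?_⟩
  filter_upwards [hβ, hL] with k hk hLk
  intro S hS n hn
  have h := hC (sch.β k) hk S n (le_trans hLk hS) hn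
  rw [ha k]
  simpa [mul_assoc] using h

/-- **A scheme in units `a`** through the couplings `β_k = β₂ + k`, half-sides
`L_k = max (S₁ β_k) ⌈k / a(β_k)⌉₊` (so `a_k L_k ≥ k → ∞`) and ZERO renormalisations. [folklore] -/
def unitScheme (ι : Type) (a : ℝ → ℝ) (ha : ∀ β, 0 < a β) (hlim : Tendsto a atTop (𝓝 0))
    (S₁ : ℝ → ℕ) (β₂ : ℝ) : SpeciesScheme ι where
  a k := a (β₂ + k)
  a_pos k := ha _
  tendsto_a := hlim.comp (tendsto_atTop_add_const_left _ _ tendsto_natCast_atTop_atTop)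
  β k := β₂ + k
  L k := max (S₁ (β₂ + k)) ⌈(k : ℝ) / a (β₂ + k)⌉₊
  tendsto_L := by
    refine tendsto_atTop_mono (fun k => ?_) tendsto_natCast_atTop_atTop
    have hak := ha (β₂ + k)
    calc (k : ℝ) = a (β₂ + k) * ((k : ℝ) / a (β₂ + k)) := by field_simp
      _ ≤ a (β₂ + k) * (⌈(k : ℝ) / a (β₂ + k)⌉₊ : ℝ) :=
          mul_le_mul_of_nonneg_left (Nat.le_ceil _) hak.le
      _ ≤ a (β₂ + k) * ((max (S₁ (β₂ + k)) ⌈(k : ℝ) / a (β₂ + k)⌉₊ : ℕ) : ℝ) :=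
          mul_le_mul_of_nonneg_left (by exact_mod_cast le_max_right _ _) hak.le
  c _ _ := 0
  m _ _ := 0

/-- Zero renormalisations make every lattice Schwinger function of positive degree vanish. [folklore] -/
theorem latticeSchwinger_eq_zero_of_c_zero {N : ℕ} (ρ : G →* Matrix (Fin N) (Fin N) ℂ)
    (sch : SpeciesScheme (YMSpecies G)) (hc : ∀ s k, sch.c s k = 0) (k n : ℕ) (hn : n ≠ 0)
    (σ : Fin n → YMSpecies G) (f : Fin n → SchwartzMap (EuclideanSpace ℝ (Fin 4)) ℝ) :
    latticeSchwinger ρ sch (fun s => s.F) k n σ f = 0 := by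
  obtain ⟨j, rfl⟩ := Nat.exists_eq_succ_of_ne_zero hn
  simp [latticeSchwinger, smearedLatticeField, hc]

/-- With zero renormalisations the vacuum-only OS data satisfy `IsYangMillsFor` along ANY
scheme (generalises the tree's `isYangMillsFor_vacuum`). [folklore] -/
theorem isYangMillsFor_vacuum_of_c_zero (r : LatticeRep G)
    (sch : SpeciesScheme (YMSpecies G)) (hc : ∀ s k, sch.c s k = 0) :
    IsYangMillsFor r sch (OSData.vacuum (YMSpecies G) 4) := by
  intro n hn σ f F _ _
  have hS : (OSData.vacuum (YMSpecies G) 4).schwinger n σ F = 0 := by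
    simp [OSData.vacuum, LabelledSchwingerFamily.trivial_of_ne_zero (YMSpecies G) hn]
  rw [hS]
  refine tendsto_const_nhds.congr' (Eventually.of_forall fun k => ?_)
  show (0 : ℂ) = ((latticeSchwinger r.ρ sch (fun s => s.F) k n σ f : ℝ) : ℂ)
  rw [latticeSchwinger_eq_zero_of_c_zero r.ρ sch hc k n hn σ f]
  simp

/-- **Tightness: the conclusion minus `IsNontrivial ∧ IsNonGaussian` follows from `a > 0`,
`a → 0` and H3 alone** (vacuum OS data, zero renormalisations, `unitScheme`). Hence all the
content of the crux is a NON-vacuum `T` tied to the lattice by `IsYangMillsFor`; the units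
clause and the lattice-gap clause are free. [folklore] -/
theorem concl_sans_nontriviality (r : LatticeRep G) {a : ℝ → ℝ} (ha : ∀ β, 0 < a β)
    (hlim : Tendsto a atTop (𝓝 0)) (h3 : GapInUnits G r a) :
    ∃ (sch : SpeciesScheme (YMSpecies G)) (T : OSData (YMSpecies G) 4),
      (∀ k, sch.a k = a (sch.β k)) ∧ IsYangMillsFor r sch T ∧ ∃ Δ > 0, HasLatticeMassGap r sch Δ := by
  obtain ⟨c₁, β₂, S₁, hc₁, hgap⟩ := h3
  refine ⟨unitScheme _ a ha hlim S₁ β₂, OSData.vacuum _ 4, fun k => rfl,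
    isYangMillsFor_vacuum_of_c_zero r _ (fun _ _ => rfl), c₁, hc₁, ?_⟩
  refine hasLatticeMassGap_of_gapInUnits r hgap _ (fun k => rfl)
    (Eventually.of_forall fun k => ?_) (Eventually.of_forall fun k => le_max_left _ _)
  show β₂ ≤ β₂ + k
  exact le_add_of_nonneg_right (Nat.cast_nonneg k)

/-- In H1 form: the two-point package supplies `a > 0`, `a → 0`, so H1 ∧ H3 give the conclusion
minus non-triviality (H2 unused, the BOUNDS of H1 unused). [folklore] -/
theorem concl_sans_nontriviality' (r : LatticeRep G) {a : ℝ → ℝ} (h1 : TwoPoint G r a)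
    (h3 : GapInUnits G r a) :
    ∃ (sch : SpeciesScheme (YMSpecies G)) (T : OSData (YMSpecies G) 4),
      (∀ k, sch.a k = a (sch.β k)) ∧ IsYangMillsFor r sch T ∧ ∃ Δ > 0, HasLatticeMassGap r sch Δ := by
  obtain ⟨_, _, _, _, _, _, _, ha, hlim, _⟩ := h1
  exact concl_sans_nontriviality r ha hlim h3

end Tightness

/-! ## §4 Junk audit: trivial gauge groups make H1 fail (no junk refutation if `IsCompactSimpleLieGroup` is dropped) -/

section Junk

variable {G : Type} [Group G] [TopologicalSpace G] [IsTopologicalGroup G] [CompactSpace G]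
  [MeasurableSpace G] [BorelSpace G]

omit [TopologicalSpace G] [IsTopologicalGroup G] [CompactSpace G] [MeasurableSpace G] [BorelSpace G] in
/-- For a trivial gauge group the plaquette field `N − Re tr r(U_p)` vanishes identically. [folklore] -/
theorem plaquetteField_eq_zero_of_subsingleton [Subsingleton G] {N : ℕ}
    (ρ : G →* Matrix (Fin N) (Fin N) ℂ) {L : ℕ} (U : GaugeConfig 4 L G) (x : Fin 4 → ZMod L)
    (i j : Fin 4) : (N : ℝ) - (ρ (plaquetteHolonomy U x i j)).trace.re = 0 := by
  rw [Subsingleton.elim (plaquetteHolonomy U x i j) 1, map_one, Matrix.trace_one]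
  simp

/-- **No junk refutation through the gauge group.** For a trivial `G` (any `r`, any `a`) the
two-point package H1 FAILS: all plaquette covariances vanish while H1 demands
`0 < c Γ(a β) ≤ Cov` on the femto torus `L = 8`, which exists since `a → 0`. So on junk groups
the crux holds vacuously; `IsCompactSimpleLieGroup` is not where a disprover can bite. [folklore] -/
theorem not_twoPoint_of_subsingleton [Subsingleton G] (r : LatticeRep G) (a : ℝ → ℝ) :
    ¬ TwoPoint G r a := by
  rintro ⟨Γ, β₀, ℓ₀, c, C, hℓ, hc, hpos, hlim, hΓ, H⟩
  -- a femto coupling for the box L = 8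
  have hev : ∀ᶠ β in atTop, a β < ℓ₀ / 8 :=
    hlim.eventually (gt_mem_nhds (by positivity))
  obtain ⟨β, hβ₀, hβ⟩ := ((eventually_ge_atTop β₀).and hev).exists
  have h8 : ((8 : ℕ) : ℝ) * a β ≤ ℓ₀ := by push_cast; linarith
  have hmain := ((H 8 β hβ₀ h8).1 1 le_rfl (by norm_num)).1
  simp only [plaquetteField_eq_zero_of_subsingleton, mul_zero, Nat.cast_one, one_mul,
    one_pow] at hmain
  have hE : wilsonExpectation (d := 4) (L := 8) r.ρ β (fun _ : GaugeConfig 4 8 G => (0 : ℝ)) = 0 := by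
    simp [wilsonExpectation]
  rw [hE] at hmain
  simp only [mul_zero, sub_self] at hmain
  have hΓpos := (hΓ (a β) (hpos β) (by linarith)).1
  have : 0 < c * Γ (a β) := mul_pos hc hΓpos
  linarith

/-- Consequently the crux's implication holds (vacuously) at every trivial gauge group. [folklore] -/
theorem crux_pointwise_of_subsingleton [Subsingleton G] (r : LatticeRep G) (a : ℝ → ℝ) :
    TwoPoint G r a → Skewness G r a → GapInUnits G r a → Concl G r a :=
  fun h1 _ _ => absurd h1 (not_twoPoint_of_subsingleton r a)

end Junk


/-! ## §5 Hypothesis gap: the scheme's tori are never femto -/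

section HypothesisGap

/-- **The conclusion lives on non-femto tori.** For ANY scheme in units `a` and any femto
radius `ℓ₀`, the scheme's own tori (side `2L_k+1`, coupling `β_k`) eventually violate the femto
condition `side · a(β) ≤ ℓ₀` of H1/H2 (because `a_k L_k → ∞`). So H1 and H2, instantiated at the
very measures `IsYangMillsFor`/`HasLatticeMassGap` integrate against, are eventually VACUOUS: the
dimension-8 amplitude on large tori ("decoupling") is an input the hypotheses do not contain. [folklore] -/
theorem scheme_tori_eventually_not_femto {ι : Type} (sch : SpeciesScheme ι) {a : ℝ → ℝ}
    (ha : ∀ k, sch.a k = a (sch.β k)) (ℓ₀ : ℝ) :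
    ∀ᶠ k in atTop, ℓ₀ < (sch.side k : ℝ) * a (sch.β k) := by
  filter_upwards [sch.tendsto_L.eventually (eventually_gt_atTop ℓ₀)] with k hk
  rw [← ha k]
  calc ℓ₀ < sch.a k * sch.L k := hk
    _ ≤ sch.a k * (sch.side k : ℝ) := by
        refine mul_le_mul_of_nonneg_left ?_ (sch.a_pos k).le
        unfold SpeciesScheme.side
        push_cast
        linarith [(Nat.cast_nonneg (sch.L k) : (0 : ℝ) ≤ _)]
    _ = (sch.side k : ℝ) * sch.a k := mul_comm _ _

end HypothesisGap

/-! ## §6 Only trivial reparametrisations provably preserve the hypotheses -/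

section Reparametrisation

variable {G : Type} [Group G] [TopologicalSpace G] [IsTopologicalGroup G] [CompactSpace G]
  [MeasurableSpace G] [BorelSpace G]

/-- H1 never sees the unit map below a threshold: any positive `a'` agreeing with `a` on
`[βs, ∞)` inherits H1 (same `Γ, ℓ₀, c, C`, threshold `max β₀ βs`). [folklore] -/
theorem twoPoint_congr_above (r : LatticeRep G) {a a' : ℝ → ℝ} (βs : ℝ) (hpos : ∀ β, 0 < a' β)
    (heq : ∀ β, βs ≤ β → a' β = a β) (h : TwoPoint G r a) : TwoPoint G r a' := by
  obtain ⟨Γ, β₀, ℓ₀, c, C, hℓ, hc, -, hlim, hΓ, H⟩ := h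
  refine ⟨Γ, max β₀ βs, ℓ₀, c, C, hℓ, hc, hpos, ?_, hΓ, ?_⟩
  · exact hlim.congr' (by
      filter_upwards [eventually_ge_atTop βs] with β hβ using (heq β hβ).symm)
  · intro L _ β hβ hL
    rw [heq β (le_of_max_le_right hβ)] at hL ⊢
    exact H L β (le_of_max_le_left hβ) hL

/-- H2 likewise. [folklore] -/
theorem skewness_congr_above (r : LatticeRep G) {a a' : ℝ → ℝ} (βs : ℝ)
    (heq : ∀ β, βs ≤ β → a' β = a β) (h : Skewness G r a) : Skewness G r a' := by
  obtain ⟨Γ₃, β₁, ℓ₁, c₃, hℓ, hc, hΓ, H⟩ := h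
  refine ⟨Γ₃, max β₁ βs, ℓ₁, c₃, hℓ, hc, hΓ, ?_⟩
  intro L _ β hβ hL
  rw [heq β (le_of_max_le_right hβ)] at hL ⊢
  exact H L β (le_of_max_le_left hβ) hL

/-- H3 likewise (same rate `c₁`, same `S₁`, threshold `max β₂ βs`). [folklore] -/
theorem gapInUnits_congr_above (r : LatticeRep G) {a a' : ℝ → ℝ} (βs : ℝ)
    (heq : ∀ β, βs ≤ β → a' β = a β) (h : GapInUnits G r a) : GapInUnits G r a' := by
  obtain ⟨c₁, β₂, S₁, hc, H⟩ := h
  refine ⟨c₁, max β₂ βs, S₁, hc, fun A B => ?_⟩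
  obtain ⟨C, hC⟩ := H A B
  refine ⟨C, fun β hβ S n hS hn => ?_⟩
  rw [heq β (le_of_max_le_right hβ)]
  exact hC β (le_of_max_le_left hβ) S n hS hn

/-- Rescaling the unit, `a ↦ t a` with `t > 0`, preserves H3 (rate `c₁ ↦ c₁ / t`). [folklore] -/
theorem gapInUnits_smul (r : LatticeRep G) {a : ℝ → ℝ} {t : ℝ} (ht : 0 < t)
    (h : GapInUnits G r a) : GapInUnits G r (fun β => t * a β) := by
  obtain ⟨c₁, β₂, S₁, hc, H⟩ := h
  refine ⟨c₁ / t, β₂, S₁, div_pos hc ht, fun A B => ?_⟩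
  obtain ⟨C, hC⟩ := H A B
  refine ⟨C, fun β hβ S n hS hn => ?_⟩
  have : c₁ / t * (t * a β) * n = c₁ * a β * n := by field_simp
  rw [this]
  exact hC β hβ S n hS hn

end Reparametrisation


/-! ## §7 A natural strengthening refuted: renormalisations are witness data (the ∀-scheme form is false) -/

section ForallScheme

variable {G : Type} [Group G] [TopologicalSpace G] [IsTopologicalGroup G] [CompactSpace G]
  [MeasurableSpace G] [BorelSpace G]

/-- If every species of the string `σ` is unrenormalised at step `k` (`c_{σ i}(k) = 0`), the
lattice Schwinger function of positive degree vanishes at step `k`. [folklore] -/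
theorem latticeSchwinger_eq_zero_of_c_string_zero {N : ℕ} (ρ : G →* Matrix (Fin N) (Fin N) ℂ)
    (sch : SpeciesScheme (YMSpecies G)) (k n : ℕ) (hn : n ≠ 0) (σ : Fin n → YMSpecies G)
    (hc : ∀ i, sch.c (σ i) k = 0) (f : Fin n → SchwartzMap (EuclideanSpace ℝ (Fin 4)) ℝ) :
    latticeSchwinger ρ sch (fun s => s.F) k n σ f = 0 := by
  obtain ⟨j, rfl⟩ := Nat.exists_eq_succ_of_ne_zero hn
  simp [latticeSchwinger, smearedLatticeField, hc]

omit [TopologicalSpace G] [IsTopologicalGroup G] [CompactSpace G] [MeasurableSpace G] [BorelSpace G] in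
/-- One-variable test functions are off-diagonal (empty coincidence locus). [folklore] -/
theorem isOffDiagonal_fin_one (F : SchwartzMap (Fin 1 → EuclideanSpace ℝ (Fin 4)) ℂ) :
    IsOffDiagonal F := by
  intro x hx
  obtain ⟨i, j, hij, -⟩ := hx
  exact absurd (Subsingleton.elim i j) hij

/-- Along a scheme tied to `T` by `IsYangMillsFor`, the Schwinger functions of a string that is
unrenormalised at every step vanish on every real off-diagonal tensor. [folklore] -/
theorem schwinger_eq_zero_of_c_string_zero (r : LatticeRep G) (sch : SpeciesScheme (YMSpecies G))
    (T : OSData (YMSpecies G) 4) (hYM : IsYangMillsFor r sch T) {n : ℕ} (hn : n ≠ 0)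
    (σ : Fin n → YMSpecies G) (hc : ∀ k i, sch.c (σ i) k = 0)
    (f : Fin n → SchwartzMap (EuclideanSpace ℝ (Fin 4)) ℝ)
    (F : SchwartzMap (Fin n → EuclideanSpace ℝ (Fin 4)) ℂ)
    (hF : IsTensorOf F (fun i => ofRealTest (f i))) (hoff : IsOffDiagonal F) :
    T.schwinger n σ F = 0 := by
  have ht := hYM n hn σ f F hF hoff
  have hz : (fun k : ℕ => ((latticeSchwinger r.ρ sch (fun s => s.F) k n σ f : ℝ) : ℂ)) =
      fun _ => 0 := by
    funext k
    rw [latticeSchwinger_eq_zero_of_c_string_zero r.ρ sch k n hn σ (hc k) f]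
    simp
  rw [hz] at ht
  exact tendsto_nhds_unique ht tendsto_const_nhds

/-- **The curvature renormalisation is load-bearing.** If `c_{curv}(k) = 0` for every `k`, NO OS
datum tied to the scheme by `IsYangMillsFor` is non-trivial in the curvature field (bridge
`not_twoPointNontrivial_of_factorizes` from the `HypercubicLimit` negative file: the complex
time-ordered clause reduces to real half-space tensors, on which `IsYangMillsFor` pins `T` to the
vanishing lattice limits). [folklore] -/
theorem not_isNontrivial_of_curv_unrenormalised (r : LatticeRep G)
    (sch : SpeciesScheme (YMSpecies G)) (hc : ∀ k, sch.c r.curvature k = 0)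
    (T : OSData (YMSpecies G) 4) (hYM : IsYangMillsFor r sch T) :
    ¬ T.IsNontrivial r.curvature := by
  unfold OSData.IsNontrivial
  apply Theorems.HypercubicLimit.Negative.not_twoPointNontrivial_of_factorizes
  intro u v hu hv
  have h2 := schwinger_eq_zero_of_c_string_zero r sch T hYM (by norm_num) (fun _ => r.curvature)
    (fun k _ => hc k) ![u, v] _ (Theorems.HypercubicLimit.Negative.isTensorOf_tensor₂ u v)
    (Theorems.HypercubicLimit.Negative.isOffDiagonal_of_halfSpaces hu hv
      (Theorems.HypercubicLimit.Negative.isTensorOf_tensor₂ u v))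
  have h1 := schwinger_eq_zero_of_c_string_zero r sch T hYM one_ne_zero (fun _ => r.curvature)
    (fun k _ => hc k) ![u] _ (Theorems.HypercubicLimit.Negative.isTensorOf_tensor₁ u)
    (isOffDiagonal_fin_one _)
  rw [h2, h1, zero_mul]

/-- **The ∀-scheme strengthening of the conclusion is FALSE** (for every `G`, `r` and every unit
map with `a > 0`, `a → 0`, every `S₁, β₂`): it is not true that EVERY scheme in units `a` with
`β_k → ∞` and `L_k ≥ S₁(β_k)` carries OS data that are Yang–Mills along it and non-trivial —
the zero-renormalisation `unitScheme` carries only curvature-trivial ones. The `∃ sch` of the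
crux (renormalisations as witness DATA, Jaffe–Witten fn. 1) is essential. [folklore] -/
theorem not_forall_scheme_strengthening (r : LatticeRep G) {a : ℝ → ℝ} (ha : ∀ β, 0 < a β)
    (hlim : Tendsto a atTop (𝓝 0)) (S₁ : ℝ → ℕ) (β₂ : ℝ) :
    ¬ ∀ sch : SpeciesScheme (YMSpecies G), (∀ k, sch.a k = a (sch.β k)) →
        Tendsto sch.β atTop atTop → (∀ k, S₁ (sch.β k) ≤ sch.L k) →
          ∃ T : OSData (YMSpecies G) 4, IsYangMillsFor r sch T ∧ T.IsNontrivial r.curvature := by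
  intro h
  obtain ⟨T, hYM, hNT⟩ := h (unitScheme _ a ha hlim S₁ β₂) (fun _ => rfl)
    (tendsto_atTop_add_const_left _ _ tendsto_natCast_atTop_atTop) (fun _ => le_max_left _ _)
  exact not_isNontrivial_of_curv_unrenormalised r _ (fun _ => rfl) T hYM hNT

end ForallScheme

/-! ## §6 addendum (gen 2): H3 passes to every smaller unit map -/

section GapMono

variable {G : Type} [Group G] [TopologicalSpace G] [IsTopologicalGroup G] [CompactSpace G]
  [MeasurableSpace G] [BorelSpace G]

/-- **H3 is antitone in the unit map.** If `a' ≤ a` above a threshold then `GapInUnits a` implies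
`GapInUnits a'` (same rate `c₁`, same `S₁`, constants `max C 0`, threshold `max β₂ βs`): along the
fake-unit-map deformation `a' ≪ a` of §6 the gap clause only weakens. No positivity of `a'` is
needed. [folklore] -/
theorem gapInUnits_mono (r : LatticeRep G) {a a' : ℝ → ℝ} (βs : ℝ)
    (hle : ∀ β, βs ≤ β → a' β ≤ a β) (h : GapInUnits G r a) : GapInUnits G r a' := by
  obtain ⟨c₁, β₂, S₁, hc, H⟩ := h
  refine ⟨c₁, max β₂ βs, S₁, hc, fun A B => ?_⟩
  obtain ⟨C, hC⟩ := H A B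
  refine ⟨max C 0, fun β hβ S n hS hn => ?_⟩
  have h1 := hC β (le_of_max_le_left hβ) S n hS hn
  have hexp : Real.exp (-(c₁ * a β * n)) ≤ Real.exp (-(c₁ * a' β * n)) := by
    apply Real.exp_le_exp.mpr
    have := hle β (le_of_max_le_right hβ)
    have hn0 : (0 : ℝ) ≤ n := Nat.cast_nonneg n
    nlinarith [mul_le_mul_of_nonneg_right this hn0]
  calc |latticeConnectedCorr r.ρ β (2 * S + 1) A.F B.F n| ≤ C * Real.exp (-(c₁ * a β * n)) := h1
    _ ≤ max C 0 * Real.exp (-(c₁ * a β * n)) :=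
        mul_le_mul_of_nonneg_right (le_max_left _ _) (Real.exp_pos _).le
    _ ≤ max C 0 * Real.exp (-(c₁ * a' β * n)) :=
        mul_le_mul_of_nonneg_left hexp (le_max_right _ _)

end GapMono

/-! ## §8 The ultralocality no-go behind the fake-unit-map threat (abstract core, proved)

The dictionary [A]–[D] and the repair menu R1–R3 are in the module docblock. -/

section Ultralocal

/-- Zeros propagate forward along a log-convex sequence: `h 1 = 0 ⇒ h n = 0` for all `n ≥ 1`
(so a 3-term log-convex non-negative sequence is either `(h₀, 0, 0, …)` or positive from `1` on).
[folklore] -/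
theorem logConvex_eq_zero_of_one {h : ℕ → ℝ}
    (hlc : ∀ n, h (n + 1) ^ 2 ≤ h n * h (n + 2)) (h1 : h 1 = 0) :
    ∀ n, 1 ≤ n → h n = 0 := by
  intro n hn
  induction n with
  | zero => omega
  | succ k ih =>
    rcases Nat.eq_zero_or_pos k with rfl | hk
    · simpa using h1
    · have hk0 : h k = 0 := ih hk
      obtain ⟨j, rfl⟩ : ∃ j, k = j + 1 := ⟨k - 1, by omega⟩
      have hsq : h (j + 1 + 1) ^ 2 ≤ 0 := by
        have := hlc (j + 1)
        rw [hk0, zero_mul] at this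
        exact this
      exact pow_eq_zero_iff (two_ne_zero) |>.mp (le_antisymm hsq (sq_nonneg _))

/-- Positivity propagates along a log-convex sequence with `h 0, h 1 > 0`. [folklore] -/
theorem logConvex_pos {h : ℕ → ℝ}
    (hlc : ∀ n, h (n + 1) ^ 2 ≤ h n * h (n + 2)) (hp0 : 0 < h 0) (hp1 : 0 < h 1) :
    ∀ n, 0 < h n := by
  intro n
  induction n using Nat.strong_induction_on with
  | _ n ih =>
    match n with
    | 0 => exact hp0
    | 1 => exact hp1
    | k + 2 =>
      have hk : 0 < h k := ih k (by omega)
      have hk1 : 0 < h (k + 1) := ih (k + 1) (by omega)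
      by_contra hneg
      push Not at hneg
      nlinarith [hlc k, mul_pos hk1 hk1, hk, hneg]

/-- A non-negative log-convex sequence positive at `0` and at some `s ≥ 1` is positive
everywhere. [folklore] -/
theorem logConvex_pos_of_pos_at {h : ℕ → ℝ} (h0 : ∀ n, 0 ≤ h n)
    (hlc : ∀ n, h (n + 1) ^ 2 ≤ h n * h (n + 2)) (hp0 : 0 < h 0) {s : ℕ} (hs : 1 ≤ s)
    (hps : 0 < h s) : ∀ n, 0 < h n := by
  refine logConvex_pos hlc hp0 ?_
  rcases (h0 1).lt_or_eq with h1 | h1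
  · exact h1
  · exact absurd (logConvex_eq_zero_of_one hlc h1.symm s hs) hps.ne'

/-- Ratio monotonicity of a positive log-convex sequence, cleared of denominators:
`h (m+1) / h m ≤ h (m+s+1) / h (m+s)`. [folklore] -/
theorem logConvex_ratio_mono {h : ℕ → ℝ} (hpos : ∀ n, 0 < h n)
    (hlc : ∀ n, h (n + 1) ^ 2 ≤ h n * h (n + 2)) :
    ∀ m s : ℕ, h (m + 1) * h (m + s) ≤ h m * h (m + s + 1) := by
  intro m s
  induction s with
  | zero => simp [mul_comm]
  | succ s ih =>
    have hl := hlc (m + s)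
    have hp := hpos (m + s)
    have hp1 := hpos (m + s + 1)
    have hm := hpos m
    have key : h (m + 1) * h (m + s + 1) * h (m + s) ≤ h m * h (m + s + 2) * h (m + s) := by
      calc h (m + 1) * h (m + s + 1) * h (m + s)
          = (h (m + 1) * h (m + s)) * h (m + s + 1) := by ring
        _ ≤ (h m * h (m + s + 1)) * h (m + s + 1) :=
            mul_le_mul_of_nonneg_right ih hp1.le
        _ = h m * h (m + s + 1) ^ 2 := by ring
        _ ≤ h m * (h (m + s) * h (m + s + 2)) := mul_le_mul_of_nonneg_left hl hm.le
        _ = h m * h (m + s + 2) * h (m + s) := by ring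
    have := le_of_mul_le_mul_right key hp
    simpa [Nat.add_assoc] using this

/-- Block inequality: `h s / h 0 ≤ h (m+s) / h m` for a positive log-convex sequence. [folklore] -/
theorem logConvex_block {h : ℕ → ℝ} (hpos : ∀ n, 0 < h n)
    (hlc : ∀ n, h (n + 1) ^ 2 ≤ h n * h (n + 2)) :
    ∀ m s : ℕ, h s * h m ≤ h (m + s) * h 0 := by
  intro m s
  induction s with
  | zero => simp [mul_comm]
  | succ s ih =>
    have hr : h (s + 1) * h (s + m) ≤ h s * h (s + m + 1) := logConvex_ratio_mono hpos hlc s m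
    have hs := hpos s
    have hm := hpos m
    have hsm1 := hpos (s + m + 1)
    have key : h (s + 1) * h m * (h s * h (m + s)) ≤
        h (m + (s + 1)) * h 0 * (h s * h (m + s)) := by
      calc h (s + 1) * h m * (h s * h (m + s))
          = (h (s + 1) * h (s + m)) * (h s * h m) := by rw [Nat.add_comm m s]; ring
        _ ≤ (h s * h (s + m + 1)) * (h s * h m) :=
            mul_le_mul_of_nonneg_right hr (mul_pos hs hm).le
        _ = (h s * h m) * (h s * h (s + m + 1)) := by ring
        _ ≤ (h (m + s) * h 0) * (h s * h (s + m + 1)) :=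
            mul_le_mul_of_nonneg_right ih (mul_pos hs hsm1).le
        _ = h (m + (s + 1)) * h 0 * (h s * h (m + s)) := by
            rw [show s + m + 1 = m + (s + 1) by omega, Nat.add_comm m s]; ring
    have hpos2 : 0 < h s * h (m + s) := mul_pos hs (hpos _)
    exact le_of_mul_le_mul_right key hpos2

/-- Power inequality: `(h s / h 0) ^ q ≤ h (q s) / h 0` for a positive log-convex sequence
(log-convexity along the arithmetic progression `0, s, 2s, …`). [folklore] -/
theorem logConvex_pow_le {h : ℕ → ℝ} (hpos : ∀ n, 0 < h n)
    (hlc : ∀ n, h (n + 1) ^ 2 ≤ h n * h (n + 2)) :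
    ∀ q s : ℕ, h s ^ q * h 0 ≤ h (q * s) * h 0 ^ q := by
  intro q s
  induction q with
  | zero => simp
  | succ q ih =>
    have hb := logConvex_block hpos hlc (q * s) s
    have hs := hpos s
    have h0 := hpos 0
    calc h s ^ (q + 1) * h 0 = h s * (h s ^ q * h 0) := by ring
      _ ≤ h s * (h (q * s) * h 0 ^ q) := mul_le_mul_of_nonneg_left ih hs.le
      _ = (h s * h (q * s)) * h 0 ^ q := by ring
      _ ≤ (h (q * s + s) * h 0) * h 0 ^ q := mul_le_mul_of_nonneg_right hb (pow_pos h0 q).le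
      _ = h ((q + 1) * s) * h 0 ^ (q + 1) := by rw [Nat.succ_mul]; ring

/-- **Abstract ultralocality no-go** (the mechanism of §6 / ideator-2 F1, kernel-checked). Let
`G k : ℕ → ℝ` be non-negative log-convex sequences (bare centred OS two-point functions in the
lattice time separation at step `k`), `c k` scalars (squared curvature renormalisations),
`s k : ℕ` the lattice index of one physical separation `σ > 0` and `q : ℕ`. If the renormalised
values converge to POSITIVE limits at separation `0` (non-triviality, diagonalised by RP) and at
`s k` (continuity of the limit under small translations), then the bare ratios
`G k (q · s k) / G k 0` cannot tend to `0` — whereas two-sided clustering in units `b` with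
`b/a → ∞` along the scheme forces exactly that for `q σ` beyond the lower bound's horizon. So along
a fake unit map (`a ≪ a_phys`) no `IsYangMillsFor`-limit is `IsNontrivial` in the curvature —
GIVEN the two-sided large-torus clustering input [D] of the docblock, which is not a hypothesis of
the crux and not provable today. [folklore] -/
theorem ultralocality_noGo {G : ℕ → ℕ → ℝ} {c : ℕ → ℝ} {s : ℕ → ℕ} {q : ℕ} {S₀ Sσ : ℝ}
    (hG0 : ∀ k n, 0 ≤ G k n) (hlc : ∀ k n, G k (n + 1) ^ 2 ≤ G k n * G k (n + 2))
    (h0 : Tendsto (fun k => c k * G k 0) atTop (𝓝 S₀)) (hS₀ : 0 < S₀)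
    (hσ : Tendsto (fun k => c k * G k (s k)) atTop (𝓝 Sσ)) (hSσ : 0 < Sσ)
    (hdecay : Tendsto (fun k => G k (q * s k) / G k 0) atTop (𝓝 0)) : False := by
  set ρ : ℝ := min (Sσ / (4 * S₀)) (1 / 2) with hρ
  have hρpos : 0 < ρ := lt_min (by positivity) (by norm_num)
  have hρle : ρ ≤ 1 := (min_le_right _ _).trans (by norm_num)
  have hρle' : ρ ≤ Sσ / (4 * S₀) := min_le_left _ _
  have e0 : ∀ᶠ k in atTop, S₀ / 2 < c k * G k 0 := h0.eventually (lt_mem_nhds (by linarith))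
  have e0' : ∀ᶠ k in atTop, c k * G k 0 < 2 * S₀ := h0.eventually (gt_mem_nhds (by linarith))
  have eσ : ∀ᶠ k in atTop, Sσ / 2 < c k * G k (s k) := hσ.eventually (lt_mem_nhds (by linarith))
  have ed : ∀ᶠ k in atTop, G k (q * s k) / G k 0 < ρ ^ q :=
    hdecay.eventually (gt_mem_nhds (pow_pos hρpos q))
  obtain ⟨k, hk0, hk0', hkσ, hkd⟩ := (e0.and (e0'.and (eσ.and ed))).exists
  have hG0pos : 0 < G k 0 := by
    rcases (hG0 k 0).lt_or_eq with h | h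
    · exact h
    · exfalso; rw [← h, mul_zero] at hk0; linarith
  have hcpos : 0 < c k := by
    by_contra hc
    push Not at hc
    nlinarith [hG0 k 0]
  have hGσpos : 0 < G k (s k) := by
    by_contra hh
    push Not at hh
    nlinarith
  have hs : 1 ≤ s k := by
    by_contra hs'
    have hs0 : s k = 0 := by omega
    rw [hs0, mul_zero, div_self hG0pos.ne'] at hkd
    exact absurd (hkd.trans_le (pow_le_one₀ hρpos.le hρle)) (lt_irrefl _)
  have hpos : ∀ n, 0 < G k n := logConvex_pos_of_pos_at (hG0 k) (hlc k) hG0pos hs hGσpos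
  have hratio : ρ * G k 0 ≤ G k (s k) := by
    have h1 : Sσ * G k 0 ≤ 4 * S₀ * G k (s k) := by
      nlinarith [mul_le_mul_of_nonneg_right hkσ.le (hG0 k 0),
        mul_le_mul_of_nonneg_right hk0'.le (hG0 k (s k))]
    have h4S : 0 < 4 * S₀ := by positivity
    calc ρ * G k 0 ≤ Sσ / (4 * S₀) * G k 0 := mul_le_mul_of_nonneg_right hρle' (hG0 k 0)
      _ = Sσ * G k 0 / (4 * S₀) := by ring
      _ ≤ 4 * S₀ * G k (s k) / (4 * S₀) := div_le_div_of_nonneg_right h1 h4S.le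
      _ = G k (s k) := by field_simp
  have hpow := logConvex_pow_le hpos (hlc k) q (s k)
  have h2 : (ρ * G k 0) ^ q * G k 0 ≤ G k (q * s k) * G k 0 ^ q :=
    (mul_le_mul_of_nonneg_right
      (pow_le_pow_left₀ (mul_pos hρpos hG0pos).le hratio q) hG0pos.le).trans hpow
  have h3 : ρ ^ q * G k 0 ≤ G k (q * s k) := by
    have : ρ ^ q * G k 0 * G k 0 ^ q ≤ G k (q * s k) * G k 0 ^ q := by
      calc ρ ^ q * G k 0 * G k 0 ^ q = (ρ * G k 0) ^ q * G k 0 := by ring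
        _ ≤ G k (q * s k) * G k 0 ^ q := h2
    exact le_of_mul_le_mul_right this (pow_pos hG0pos q)
  have h4 : ρ ^ q ≤ G k (q * s k) / G k 0 := by
    rw [le_div_iff₀ hG0pos]; exact h3
  linarith

end Ultralocal

/-! ## §9 H1 pins commensurable plateaux (why the fake maps must be incommensurable) -/

section Commensurable

variable {G : Type} [Group G] [TopologicalSpace G] [IsTopologicalGroup G] [CompactSpace G]
  [MeasurableSpace G] [BorelSpace G]

/-- The dimensionless axis two-point datum of H1, `n⁸ · Cov_{β,L}(P₀^{(01)}, P_{n e₂}^{(01)})` under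
`wilsonMeasure r.ρ β` on the torus `(ℤ/L)⁴` (the quantity H1 sandwiches between `cΓ` and `CΓ`). [folklore] -/
def axisCov (r : LatticeRep G) (L : ℕ) [NeZero L] (β : ℝ) (n : ℕ) : ℝ :=
  let P : (Fin 4 → ZMod L) → Fin 4 → Fin 4 → GaugeConfig 4 L G → ℝ :=
    fun x i j U => (r.N : ℝ) - (r.ρ (plaquetteHolonomy U x i j)).trace.re
  let E : (GaugeConfig 4 L G → ℝ) → ℝ := fun F => wilsonExpectation (d := 4) (L := L) r.ρ β F
  let cov : (GaugeConfig 4 L G → ℝ) → (GaugeConfig 4 L G → ℝ) → ℝ :=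
    fun F F' => E (fun U => F U * F' U) - E F * E F'
  (n : ℝ) ^ 8 * cov (P 0 0 1) (P (Pi.single (2 : Fin 4) ((n : ℕ) : ZMod L)) 0 1)

/-- The axis clause of H1, extracted: `cΓ(n a β) ≤ axisCov ≤ CΓ(n a β)` on femto tori, with `Γ > 0`
on `(0, ℓ₀]`, `c > 0`, `a > 0`. [folklore] -/
theorem TwoPoint.axis_bounds (r : LatticeRep G) {a : ℝ → ℝ} (h : TwoPoint G r a) :
    ∃ (Γ : ℝ → ℝ) (β₀ ℓ₀ c C : ℝ), 0 < ℓ₀ ∧ 0 < c ∧ (∀ β, 0 < a β) ∧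
      (∀ s : ℝ, 0 < s → s ≤ ℓ₀ → 0 < Γ s) ∧
      ∀ (L : ℕ) [NeZero L] (β : ℝ), β₀ ≤ β → (L : ℝ) * a β ≤ ℓ₀ →
        ∀ n : ℕ, 1 ≤ n → 8 * n ≤ L →
          c * Γ ((n : ℝ) * a β) ≤ axisCov r L β n ∧ axisCov r L β n ≤ C * Γ ((n : ℝ) * a β) := by
  obtain ⟨Γ, β₀, ℓ₀, c, C, hℓ, hc, hpos, -, hΓ, H⟩ := h
  refine ⟨Γ, β₀, ℓ₀, c, C, hℓ, hc, hpos, fun s hs hs' => (hΓ s hs hs').1, ?_⟩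
  intro L _ β hβ hL n hn h8
  exact (H L β hβ hL).1 n hn h8

/-- **H1 pins commensurable plateaux.** If two couplings above threshold have commensurable units,
`a β = m · a β'` with `m ≥ 1`, then on all femto tori the axis data at lattice separations `n`
(coupling `β`) and `m n` (coupling `β'`) agree up to the fixed constant `K = max (C/c) 1` of H1 —
both lie in `[cΓ(s), CΓ(s)]` at the same level `s = n · a β`. Hence H1's single shape function
enforces step scaling along every chain of couplings with rationally related units (dyadic ladders
in particular), and the fake unit maps of §6 must have pairwise incommensurable plateau values. [folklore] -/
theorem twoPoint_pins_commensurable (r : LatticeRep G) {a : ℝ → ℝ} (h : TwoPoint G r a) :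
    ∃ (β₀ ℓ₀ K : ℝ), 0 < ℓ₀ ∧ 0 < K ∧
      ∀ (m : ℕ) (β β' : ℝ), 1 ≤ m → β₀ ≤ β → β₀ ≤ β' → a β = m * a β' →
        ∀ (L L' : ℕ) [NeZero L] [NeZero L'], (L : ℝ) * a β ≤ ℓ₀ → (L' : ℝ) * a β' ≤ ℓ₀ →
          ∀ n : ℕ, 1 ≤ n → 8 * n ≤ L → 8 * (m * n) ≤ L' →
            axisCov r L β n ≤ K * axisCov r L' β' (m * n) ∧
              axisCov r L' β' (m * n) ≤ K * axisCov r L β n := by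
  obtain ⟨Γ, β₀, ℓ₀, c, C, hℓ, hc, hpos, hΓ, H⟩ := TwoPoint.axis_bounds r h
  refine ⟨β₀, ℓ₀, max (C / c) 1, hℓ, lt_max_of_lt_right one_pos, ?_⟩
  intro m β β' hm hβ hβ' hab L L' _ _ hL hL' n hn h8 h8'
  have hmn : 1 ≤ m * n := Nat.one_le_iff_ne_zero.mpr (Nat.mul_ne_zero (by omega) (by omega))
  obtain ⟨hA1, hA2⟩ := H L β hβ hL n hn h8
  obtain ⟨hB1, hB2⟩ := H L' β' hβ' hL' (m * n) hmn h8'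
  -- the two levels coincide
  have hlev : ((m * n : ℕ) : ℝ) * a β' = (n : ℝ) * a β := by
    rw [hab]; push_cast; ring
  rw [hlev] at hB1 hB2
  -- the common level is in `(0, ℓ₀]`, so `Γ > 0` there and `C ≥ c`
  have hs0 : 0 < (n : ℝ) * a β := mul_pos (by exact_mod_cast hn) (hpos β)
  have hsℓ : (n : ℝ) * a β ≤ ℓ₀ := by
    have h8r : (8 : ℝ) * n ≤ L := by exact_mod_cast h8
    nlinarith [hpos β]
  have hΓs := hΓ _ hs0 hsℓ
  have hcΓ : 0 < c * Γ ((n : ℝ) * a β) := mul_pos hc hΓs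
  have hCc : C / c * (c * Γ ((n : ℝ) * a β)) = C * Γ ((n : ℝ) * a β) := by
    field_simp
  have hK : C / c ≤ max (C / c) 1 := le_max_left _ _
  have hApos : 0 ≤ axisCov r L β n := hcΓ.le.trans hA1
  have hBpos : 0 ≤ axisCov r L' β' (m * n) := hcΓ.le.trans hB1
  constructor
  · calc axisCov r L β n ≤ C * Γ ((n : ℝ) * a β) := hA2
      _ = C / c * (c * Γ ((n : ℝ) * a β)) := hCc.symm
      _ ≤ C / c * axisCov r L' β' (m * n) := by
          have hCcpos : 0 ≤ C / c := by
            have : c * Γ ((n : ℝ) * a β) ≤ C * Γ ((n : ℝ) * a β) := hA1.trans hA2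
            have hcC : c ≤ C := le_of_mul_le_mul_right this hΓs
            exact div_nonneg (hc.le.trans hcC) hc.le
          exact mul_le_mul_of_nonneg_left hB1 hCcpos
      _ ≤ max (C / c) 1 * axisCov r L' β' (m * n) := mul_le_mul_of_nonneg_right hK hBpos
  · calc axisCov r L' β' (m * n) ≤ C * Γ ((n : ℝ) * a β) := hB2
      _ = C / c * (c * Γ ((n : ℝ) * a β)) := hCc.symm
      _ ≤ C / c * axisCov r L β n := by
          have hCcpos : 0 ≤ C / c := by
            have : c * Γ ((n : ℝ) * a β) ≤ C * Γ ((n : ℝ) * a β) := hA1.trans hA2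
            have hcC : c ≤ C := le_of_mul_le_mul_right this hΓs
            exact div_nonneg (hc.le.trans hcC) hc.le
          exact mul_le_mul_of_nonneg_left hA1 hCcpos
      _ ≤ max (C / c) 1 * axisCov r L β n := mul_le_mul_of_nonneg_right hK hApos

end Commensurable


end

end Summit.QuantumFields.YangMills.Cruxes.OSLegsFromFemtoAndGap.Disproof
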